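import Summits.Ventures.LatticeQCDFlow.Scaling.BooleanStarCoupling

/-!
HONEST FRAMING: exact (Metropolis-corrected) sampling algorithms for lattice gauge theory; figures
of merit are autocorrelation/cost numbers at stated couplings and volumes; no continuum-physics
claim.

# BooleanStarDoeblinHotCoupling — THE SYNCHRONOUS COUPLING OF THE BOOLEAN STAR WITH A DOEBLIN HOT SAMPLER `M_0 = a'·μ_0 + (1−a')·R`
# (THE REALISTIC FLOW PROPOSAL: AN INDEPENDENCE SAMPLER WITH WEIGHTS `≤ 1/a'`): COMMON FRESH DRAW WITH PROBABILITY `a'`, RESIDUAL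
# MOVES COMMON AT AN AGREEING HUB AND INDEPENDENT AT A DISAGREEING ONE — A MARKOVIAN COUPLING (lean-2 GEN-30, ours)

Venture-side (OURS).  Cell `lqcd-flow` (pub-lqcd), unit `pub-lqcd-lean-2-g30`, 2026-08-28.  Chapter P (OPEN-MATH-chapterM item 1 on
the two-point family), file 8.  `Scaling/BooleanStarCoupling` (P1) assumed the EXACT hot sampler `M_0(u,·) = μ_0`.  A trivializing flow used
as an independence proposal gives a hot kernel that is only MINORISED, `M_0(u,·) ≥ a'·μ_0` (`a'` = the inverse of the largest importance
weight); chapter N treated it as `M_0 = a'·Ẽ + (1−a')·R` with `R` a `μ_0`-stationary residual kernel (`Scaling/DoeblinHotRegimeFree`).  Here the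
hot kernel is carried as the hypothesis-equation `M_0(u,v) = a'·μ_0(v) + (1−a')·R(u,v)` (`0 ≤ a' ≤ 1`, `R` row-stochastic), and the
synchronous coupling is adapted at the hub only: with probability `a'` both copies receive the SAME fresh value, with probability `1−a'` they
make `R`-moves — the same move if the hubs agree, independent moves if they differ.  Cold levels as in P1 (common move at an agreeing
level, independent at a disagreeing one); the entry part is P1's verbatim.

## What is proved

* §1 `syncCold_sum_right` ∕ `_left` (the cold rows under the condition `x_k = y_k` alone), `syncDoeblinHot_sum_right` ∕ `_left` (the hub rows:
  `a'·μ_0 + (1−a')·R(x_0,·) = M_0(x_0,·)` for each copy).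
* §2 **`boolSyncDoeblin_isMarkovianCoupling`** — the adapted coupling is a Markovian coupling of `t·GSw + (1−t)·Π_w^M` with the Doeblin hot
  kernel (`m ≥ 1`, `0 ≤ t ≤ 1`, `w ≥ 0`, `μ > 0`, `M_k` and `R` row-stochastic, `0 ≤ a' ≤ 1`).

Reading (no numerics implied): the hub disagreement now dies with probability `a'` per hot update instead of `1`; everything else is
unchanged, so the cold-start law of P4 survives with `h = (1−t)w_0 ↦ a'·h` (file 9).  NOT CLAIMED: general `S`.  Literature grade (cell rule):
OWN; nothing cited; no new bib keys.
-/

noncomputable section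

open Finset Function
open Literature.Probability.MarkovChains

namespace Summit.Ventures.LatticeQCDFlow.Scaling

variable {K m : ℕ} {μ : Fin (K + 1) → Bool → ℝ} {M : Fin (K + 1) → Bool → Bool → ℝ} {R : Bool → Bool → ℝ} {w : Fin (K + 1) → ℝ}
  {t a' : ℝ}

section Coupling
variable (κ : Fin m → Fin K)

/-! ## §1 Rows of the adapted update part -/

/-- Right marginal of the cold part at level `k` (common move iff the copies agree there). [ours] -/
theorem syncCold_sum_right (hM : ∀ k, IsRowStochastic (M k)) (k : Fin (K + 1)) (x y x' : Fin (K + 1) → Bool) :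
    ∑ y' : Fin (K + 1) → Bool,
        (if x k = y k then
            ∑ v : Bool, M k (x k) v * (if x' = update x k v ∧ y' = update y k v then (1 : ℝ) else 0)
          else coordKernel M k x x' * coordKernel M k y y')
      = coordKernel M k x x' := by
  by_cases h : x k = y k
  · simp only [h, if_true]
    rw [Finset.sum_comm]
    simp_rw [← Finset.mul_sum, sum_ite_and_right]
    rw [coordKernel_eq_sum_ite, h]
  · simp only [h, if_false]
    rw [← Finset.mul_sum, sum_coordKernel_eq_one hM, mul_one]

/-- Left marginal of the cold part at level `k`. [ours] -/
theorem syncCold_sum_left (hM : ∀ k, IsRowStochastic (M k)) (k : Fin (K + 1)) (x y y' : Fin (K + 1) → Bool) :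
    ∑ x' : Fin (K + 1) → Bool,
        (if x k = y k then
            ∑ v : Bool, M k (x k) v * (if x' = update x k v ∧ y' = update y k v then (1 : ℝ) else 0)
          else coordKernel M k x x' * coordKernel M k y y')
      = coordKernel M k y y' := by
  by_cases h : x k = y k
  · simp only [h, if_true]
    rw [Finset.sum_comm]
    simp_rw [← Finset.mul_sum, sum_ite_and_left]
    rw [coordKernel_eq_sum_ite]
  · simp only [h, if_false]
    rw [← Finset.sum_mul, sum_coordKernel_eq_one hM, one_mul]

/-- **Right marginal of the adapted hub part:** `a'·μ_0(·) + (1−a')·R(x_0,·) = M_0(x_0,·)`, so the first copy moves by `P̃_0`. [ours] -/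
theorem syncDoeblinHot_sum_right (hR : IsRowStochastic R) (hM0 : ∀ u v, M 0 u v = a' * μ 0 v + (1 - a') * R u v)
    (x y x' : Fin (K + 1) → Bool) :
    ∑ y' : Fin (K + 1) → Bool,
        (a' * ∑ v : Bool, μ 0 v * (if x' = update x 0 v ∧ y' = update y 0 v then (1 : ℝ) else 0)
          + (1 - a') * (if x 0 = y 0 then
              ∑ v : Bool, R (x 0) v * (if x' = update x 0 v ∧ y' = update y 0 v then (1 : ℝ) else 0)
            else coordKernel (fun _ : Fin (K + 1) => R) 0 x x' * coordKernel (fun _ : Fin (K + 1) => R) 0 y y'))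
      = coordKernel M 0 x x' := by
  rw [Finset.sum_add_distrib, ← Finset.mul_sum, ← Finset.mul_sum, Finset.sum_comm]
  simp_rw [← Finset.mul_sum, sum_ite_and_right]
  rw [syncCold_sum_right (M := fun _ : Fin (K + 1) => R) (fun _ => hR) 0 x y x', coordKernel_eq_sum_ite, coordKernel_eq_sum_ite,
    Finset.mul_sum, Finset.mul_sum, ← Finset.sum_add_distrib]
  exact sum_congr rfl fun v _ => by rw [hM0]; ring

/-- **Left marginal of the adapted hub part.** [ours] -/
theorem syncDoeblinHot_sum_left (hR : IsRowStochastic R) (hM0 : ∀ u v, M 0 u v = a' * μ 0 v + (1 - a') * R u v)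
    (x y y' : Fin (K + 1) → Bool) :
    ∑ x' : Fin (K + 1) → Bool,
        (a' * ∑ v : Bool, μ 0 v * (if x' = update x 0 v ∧ y' = update y 0 v then (1 : ℝ) else 0)
          + (1 - a') * (if x 0 = y 0 then
              ∑ v : Bool, R (x 0) v * (if x' = update x 0 v ∧ y' = update y 0 v then (1 : ℝ) else 0)
            else coordKernel (fun _ : Fin (K + 1) => R) 0 x x' * coordKernel (fun _ : Fin (K + 1) => R) 0 y y'))
      = coordKernel M 0 y y' := by
  rw [Finset.sum_add_distrib, ← Finset.mul_sum, ← Finset.mul_sum, Finset.sum_comm]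
  simp_rw [← Finset.mul_sum, sum_ite_and_left]
  rw [syncCold_sum_left (M := fun _ : Fin (K + 1) => R) (fun _ => hR) 0 x y y', coordKernel_eq_sum_ite, coordKernel_eq_sum_ite,
    Finset.mul_sum, Finset.mul_sum, ← Finset.sum_add_distrib]
  exact sum_congr rfl fun v _ => by rw [hM0]; ring

/-! ## §2 The adapted synchronous coupling is a Markovian coupling -/

/-- **THE SYNCHRONOUS COUPLING WITH A DOEBLIN HOT SAMPLER IS A MARKOVIAN COUPLING OF `t·GSw + (1−t)·Π_w^M`** (two-point replicas, identity
entry maps on the hub list `κ`, hot kernel `M_0 = a'·μ_0 + (1−a')·R`, arbitrary row-stochastic cold kernels; `m ≥ 1`, `0 ≤ t ≤ 1`, `w ≥ 0`,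
`0 ≤ a' ≤ 1`). [ours] -/
theorem boolSyncDoeblin_isMarkovianCoupling (hm : 1 ≤ m) (ht0 : 0 ≤ t) (ht1 : t ≤ 1) (hw0 : ∀ k, 0 ≤ w k)
    (hμ : ∀ k x, 0 < μ k x) (hM : ∀ k, IsRowStochastic (M k)) (hR : IsRowStochastic R) (ha'0 : 0 ≤ a') (ha'1 : a' ≤ 1)
    (hM0 : ∀ u v, M 0 u v = a' * μ 0 v + (1 - a') * R u v)
    {α : Fin m → (Fin (K + 1) → Bool) → ℝ}
    (hα : ∀ r z, α r z = min 1 (tensorFun μ (edgeFlowSwap (Equiv.refl Bool) 0 (κ r).succ z) / tensorFun μ z))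
    {Q : (Fin (K + 1) → Bool) × (Fin (K + 1) → Bool) → (Fin (K + 1) → Bool) × (Fin (K + 1) → Bool) → ℝ}
    (hQ : ∀ a b, Q a b =
      ∑ r : Fin m, t / m *
        (min (α r a.1) (α r a.2) * (if b.1 = edgeFlowSwap (Equiv.refl Bool) 0 (κ r).succ a.1
              ∧ b.2 = edgeFlowSwap (Equiv.refl Bool) 0 (κ r).succ a.2 then (1 : ℝ) else 0)
          + (α r a.1 - min (α r a.1) (α r a.2)) * (if b.1 = edgeFlowSwap (Equiv.refl Bool) 0 (κ r).succ a.1 ∧ b.2 = a.2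
              then (1 : ℝ) else 0)
          + (α r a.2 - min (α r a.1) (α r a.2)) * (if b.1 = a.1 ∧ b.2 = edgeFlowSwap (Equiv.refl Bool) 0 (κ r).succ a.2
              then (1 : ℝ) else 0)
          + (1 - α r a.1 - α r a.2 + min (α r a.1) (α r a.2)) * (if b.1 = a.1 ∧ b.2 = a.2 then (1 : ℝ) else 0))
      + (1 - t) * ∑ k : Fin (K + 1), w k *
        (if k = 0 then
            (a' * ∑ v : Bool, μ 0 v * (if b.1 = update a.1 0 v ∧ b.2 = update a.2 0 v then (1 : ℝ) else 0)
              + (1 - a') * (if a.1 0 = a.2 0 then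
                  ∑ v : Bool, R (a.1 0) v * (if b.1 = update a.1 0 v ∧ b.2 = update a.2 0 v then (1 : ℝ) else 0)
                else coordKernel (fun _ : Fin (K + 1) => R) 0 a.1 b.1 * coordKernel (fun _ : Fin (K + 1) => R) 0 a.2 b.2))
          else
            (if a.1 k = a.2 k then
                ∑ v : Bool, M k (a.1 k) v * (if b.1 = update a.1 k v ∧ b.2 = update a.2 k v then (1 : ℝ) else 0)
              else coordKernel M k a.1 b.1 * coordKernel M k a.2 b.2))) :
    IsMarkovianCoupling (fun y z : Fin (K + 1) → Bool =>
        t * ptGraphSwap μ (fun r : Fin m => (((0 : Fin (K + 1)), (κ r).succ) : Fin (K + 1) × Fin (K + 1)))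
              (fun _ : Fin m => Equiv.refl Bool) y z
          + (1 - t) * prodKernel w M y z) Q := by
  have hmpos : (0 : ℝ) < m := Nat.cast_pos.mpr (by omega)
  have he := hubList_fst_ne_snd (K := K) κ
  have hacc := accept_mem κ (fun _ : Fin m => Equiv.refl Bool) hμ hα
  have hP : ∀ y z : Fin (K + 1) → Bool,
      t * ptGraphSwap μ (fun r : Fin m => (((0 : Fin (K + 1)), (κ r).succ) : Fin (K + 1) × Fin (K + 1)))
            (fun _ : Fin m => Equiv.refl Bool) y z + (1 - t) * prodKernel w M y z
        = ∑ r : Fin m, t / m * (α r y * (if z = edgeFlowSwap (Equiv.refl Bool) 0 (κ r).succ y then (1 : ℝ) else 0)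
            + (1 - α r y) * (if z = y then (1 : ℝ) else 0))
          + (1 - t) * ∑ k : Fin (K + 1), w k * coordKernel M k y z := by
    intro y z
    rw [ptGraphSwap_eq_avg_entryKernel (φ := fun _ : Fin m => Equiv.refl Bool) hm he hμ, prodKernel_apply, Finset.mul_sum]
    congr 1
    refine sum_congr rfl fun r _ => ?_
    rw [entrySwap_eq_accept_reject κ (fun _ : Fin m => Equiv.refl Bool) hμ hα r y z]
    ring
  have hRR : ∀ k : Fin (K + 1), IsRowStochastic ((fun _ : Fin (K + 1) => R) k) := fun _ => hR
  intro x y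
  refine ⟨fun a b => ?_, fun a => ?_, fun b => ?_⟩
  · -- non-negativity
    show 0 ≤ Q (x, y) (a, b)
    rw [hQ]
    refine add_nonneg (sum_nonneg fun r _ => mul_nonneg (by positivity) ?_)
      (mul_nonneg (by linarith) (sum_nonneg fun k _ => mul_nonneg (hw0 k) ?_))
    · obtain ⟨h1, h2, h3, h4⟩ := syncSwap_weights_nonneg (hacc r x).1 (hacc r x).2 (hacc r y).1 (hacc r y).2
      refine add_nonneg (add_nonneg (add_nonneg ?_ ?_) ?_) ?_
      · exact mul_nonneg h1 (by split_ifs <;> norm_num)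
      · exact mul_nonneg h2 (by split_ifs <;> norm_num)
      · exact mul_nonneg h3 (by split_ifs <;> norm_num)
      · exact mul_nonneg h4 (by split_ifs <;> norm_num)
    · split_ifs
      · refine add_nonneg (mul_nonneg ha'0 (sum_nonneg fun v _ => mul_nonneg (hμ 0 v).le (by split_ifs <;> norm_num)))
          (mul_nonneg (by linarith) (sum_nonneg fun v _ => mul_nonneg (hR.1 _ _) (by split_ifs <;> norm_num)))
      · exact add_nonneg (mul_nonneg ha'0 (sum_nonneg fun v _ => mul_nonneg (hμ 0 v).le (by split_ifs <;> norm_num)))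
          (mul_nonneg (by linarith) (mul_nonneg (coordKernel_nonneg _ (fun j u v => (hRR j).1 u v) 0 _ _)
            (coordKernel_nonneg _ (fun j u v => (hRR j).1 u v) 0 _ _)))
      · exact sum_nonneg fun v _ => mul_nonneg ((hM k).1 _ _) (by split_ifs <;> norm_num)
      · exact mul_nonneg (coordKernel_nonneg M (fun j u v => (hM j).1 u v) k _ _)
          (coordKernel_nonneg M (fun j u v => (hM j).1 u v) k _ _)
  · -- right marginal
    show ∑ b, Q (x, y) (a, b) = _
    simp_rw [hQ]
    rw [Finset.sum_add_distrib, ← Finset.sum_comm, ← Finset.mul_sum, hP]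
    congr 1
    · refine sum_congr rfl fun r _ => ?_
      rw [← Finset.mul_sum, syncSwap_sum_right]
    · congr 1
      rw [Finset.sum_comm]
      refine sum_congr rfl fun k _ => ?_
      rw [← Finset.mul_sum]
      congr 1
      by_cases hk : k = 0
      · subst hk; simp only [if_true]; exact syncDoeblinHot_sum_right hR hM0 x y a
      · simp only [hk, if_false]; exact syncCold_sum_right hM k x y a
  · -- left marginal
    show ∑ a, Q (x, y) (a, b) = _
    simp_rw [hQ]
    rw [Finset.sum_add_distrib, ← Finset.sum_comm, ← Finset.mul_sum, hP]
    congr 1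
    · refine sum_congr rfl fun r _ => ?_
      rw [← Finset.mul_sum, syncSwap_sum_left]
    · congr 1
      rw [Finset.sum_comm]
      refine sum_congr rfl fun k _ => ?_
      rw [← Finset.mul_sum]
      congr 1
      by_cases hk : k = 0
      · subst hk; simp only [if_true]; exact syncDoeblinHot_sum_left hR hM0 x y b
      · simp only [hk, if_false]; exact syncCold_sum_left hM k x y b

end Coupling

end Summit.Ventures.LatticeQCDFlow.Scaling

end
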